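import Summits.RiemannHypothesis.RiemannHypothesis.Theorems.PfPersistenceDialLemma
import Summits.RiemannHypothesis.RiemannHypothesis.Theorems.PfPersistenceGalerkinDownCone
import HarnessLib

/-!
# PF-persistence programme — the dial-space barrier leaf with the witness NAMED (REFEREE r7 §1 form)

LONG-ODDS MECHANISM SEARCH; NO RH CLAIMS.  Value = the referee-grade form of the uniformly-robust
barrier leaf W2-unif inside the dial space: the negative data accumulating at `ζ` are NAMED dials
`datumOf (dial p K zetaWeights)` with `K ≠ 1`, hence provably `≠ zetaDatum` (typer's `datumOf_dial_ne`,
`PfPersistenceLocalityBarrier` r2), so the conclusion is the typer's `NegativesAccumulateNe` and every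
uniformly robust criterion at `ζ` CONTAINS a detectably negative dial other than `ζ`
(`uniformlyRobustAt_contains_negative_dial`).  Inputs are TYPED, never asserted: `DialReady p β₀`
(GAP B-TYPED-2; DATA) and `PrimePatternFormBoundedOn p` (GAP B-TYPED-3; PROVED for every `p` by
fake-4's `primePattern_form_abs_le` once `PfPersistenceThetaIntegral` is in the tree — the one-line
bridge is added here in a follow-up revision).

**Revision 2 (append-only).**  `PfPersistenceGalerkinDownCone` (commit 9906fc374027) is now in the
tree, so GAP B-TYPED-3 is CLOSED here: `primePatternFormBoundedOn : ∀ p, PrimePatternFormBoundedOn p`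
is the one-line bridge from `primePattern_form_abs_le` (`0 ≼ P_p(a,N) ≼ G` in form sense, via the
autocorrelation identity and Cauchy–Schwarz in `L²(-L, L)`).  The leaf theorems are restated with that
hypothesis DISCHARGED (`…₀` names; the originals are kept verbatim): the dial-space accumulation /
"every uniformly robust criterion at `ζ` contains a negative dial `≠ ζ`" now hold MODULO `DialReady p β₀`
ONLY (GAP B-TYPED-2, which stays DATA: it is a statement about near-null profiles of `G − Z_ζ` and no
RH-free control of their autocorrelations at `log q` is known).
-/

set_option linter.dupNamespace false

noncomputable section

open Real Matrix

namespace Summit.RiemannHypothesis.RiemannHypothesis.Theorems.PfPersistence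

/-- A positive `ζ`-weight sits at `p ≥ 2` (`Λ(0) = Λ(1) = 0`). [folklore] -/
theorem two_le_of_zetaWeights_pos {p : ℕ} (hw : 0 < zetaWeights p) : 2 ≤ p := by
  by_contra h
  rw [not_le] at h
  interval_cases p <;> simp [zetaWeights] at hw

/-- A genuine dial (`K ≠ 1`) at a weighted `p` is a datum different from `ζ`. [folklore] -/
theorem datumOf_dial_ne_zetaDatum {p : ℕ} (hw : 0 < zetaWeights p) {K : ℝ} (hK : K ≠ 1) :
    datumOf (dial p K zetaWeights) ≠ zetaDatum :=
  datumOf_dial_ne (two_le_of_zetaWeights_pos hw) hK hw.ne'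

/-- **PROVED (explicit negative dials uniformly close to `ζ`, witness NAMED and `≠ ζ`; modulo the
TYPED `DialReady` / `PrimePatternFormBoundedOn`).** [folklore] -/
theorem exists_negative_dial_uniformlyClose_ne {p : ℕ} {β₀ : ℝ} (hβ₀ : 0 < β₀)
    (hw : 0 < zetaWeights p) (hP : PrimePatternFormBoundedOn p) (hready : DialReady p β₀)
    {ε : ℝ} (hε : 0 < ε) :
    ∃ (K : ℝ) (win : Window) (v : Fin (win.N + 1) → ℝ),
      K ≠ 1 ∧ datumOf (dial p K zetaWeights) ≠ zetaDatum ∧ p ∈ primeRange (2 * win.a) ∧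
      v ⬝ᵥ (evenBlock (dial p K zetaWeights) win *ᵥ v) < 0 ∧
      UniformlyClose ε zetaDatum (datumOf (dial p K zetaWeights)) := by
  obtain ⟨K, win, v, hK, hp, hneg, hclose⟩ := exists_negative_dial_uniformlyClose' hβ₀ hw hP hready hε
  have hK1 : K ≠ 1 := by
    intro h
    rw [h, sub_self, abs_zero] at hK
    have : 0 < ε / (2 * zetaWeights p) := by positivity
    linarith
  exact ⟨K, win, v, hK1, datumOf_dial_ne_zetaDatum hw hK1, hp, hneg, hclose⟩

/-- **PROVED (REFEREE r7 §1 named form of the in-domain accumulation): negatives of the dial space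
OTHER THAN `ζ` accumulate at `ζ`**, modulo the TYPED inputs. [folklore] -/
theorem negativesAccumulateNe_dialSpace_of_dialReady {p : ℕ} {β₀ : ℝ} (hβ₀ : 0 < β₀)
    (hw : 0 < zetaWeights p) (hP : PrimePatternFormBoundedOn p) (hready : DialReady p β₀) :
    NegativesAccumulateNe dialSpace zetaDatum := by
  intro ε hε
  obtain ⟨K, win, v, -, hne, -, hneg, hclose⟩ :=
    exists_negative_dial_uniformlyClose_ne hβ₀ hw hP hready hε
  exact ⟨datumOf (dial p K zetaWeights), ⟨_, rfl⟩, hne, ⟨win, v, hneg⟩, hclose⟩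

/-- **PROVED (leaf W2-unif, named witness): every criterion with an `a`-uniform modulus at `ζ`
CONTAINS a detectably negative dial `≠ ζ`** (modulo the TYPED inputs). [folklore] -/
theorem uniformlyRobustAt_contains_negative_dial {p : ℕ} {β₀ : ℝ} (hβ₀ : 0 < β₀)
    (hw : 0 < zetaWeights p) (hP : PrimePatternFormBoundedOn p) (hready : DialReady p β₀)
    {S : Set Datum} (hS : UniformlyRobustAt S zetaDatum) :
    ∃ d ∈ dialSpace, d ≠ zetaDatum ∧ d ∈ S ∧ DetectablyNegative d :=
  not_uniformlyRobust_of_negativesAccumulateNe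
    (negativesAccumulateNe_dialSpace_of_dialReady hβ₀ hw hP hready) hS

/-- The `p = 2` instance (the observatory's two-sided `lambdapert`-type dial): modulo
`DialReady 2 β₀` and `PrimePatternFormBoundedOn 2`. [folklore] -/
theorem uniformlyRobustAt_contains_negative_dial_two {β₀ : ℝ} (hβ₀ : 0 < β₀)
    (hP : PrimePatternFormBoundedOn 2) (hready : DialReady 2 β₀)
    {S : Set Datum} (hS : UniformlyRobustAt S zetaDatum) :
    ∃ d ∈ dialSpace, d ≠ zetaDatum ∧ d ∈ S ∧ DetectablyNegative d :=
  uniformlyRobustAt_contains_negative_dial hβ₀ zetaWeights_two_pos hP hready hS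

/-! ## Revision 2 — GAP B-TYPED-3 discharged -/

/-- **PROVED (GAP B-TYPED-3 closed): the guarded prime-pattern form bound holds at every `p`.**
For every window with `p ≤ 2a` and every coefficient vector `v`,
`|vᵀ P_p(a,N) v| ≤ vᵀ v` — fake-4's `primePattern_form_abs_le` (autocorrelation identity
`vᵀ P_p v = w_p(β_v(log p) + β_v(-log p))`-free form: `|β_v(t)| ≤ β_v(0) = ‖v‖²` by Cauchy–Schwarz,
`PfPersistenceGalerkinDownCone`).  The unguarded `PrimePatternFormBounded p` is REFUTED for `p ≥ 2`
(`not_primePatternFormBounded`, windows not reaching `p`); this is the correct typed replacement. [folklore] -/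
theorem primePatternFormBoundedOn (p : ℕ) : PrimePatternFormBoundedOn p :=
  fun win hp v => primePattern_form_abs_le win.ha hp v

/-- Rev-2 form of `exists_negative_dial_uniformlyClose_ne`: explicit negative dials `≠ ζ` uniformly
close to `ζ`, modulo `DialReady p β₀` ONLY. [folklore] -/
theorem exists_negative_dial_uniformlyClose_ne₀ {p : ℕ} {β₀ : ℝ} (hβ₀ : 0 < β₀)
    (hw : 0 < zetaWeights p) (hready : DialReady p β₀) {ε : ℝ} (hε : 0 < ε) :
    ∃ (K : ℝ) (win : Window) (v : Fin (win.N + 1) → ℝ),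
      K ≠ 1 ∧ datumOf (dial p K zetaWeights) ≠ zetaDatum ∧ p ∈ primeRange (2 * win.a) ∧
      v ⬝ᵥ (evenBlock (dial p K zetaWeights) win *ᵥ v) < 0 ∧
      UniformlyClose ε zetaDatum (datumOf (dial p K zetaWeights)) :=
  exists_negative_dial_uniformlyClose_ne hβ₀ hw (primePatternFormBoundedOn p) hready hε

/-- **PROVED (rev 2): negatives of the dial space OTHER THAN `ζ` accumulate at `ζ`, modulo
`DialReady p β₀` only** (some weighted `p`, some `β₀ > 0`). [folklore] -/
theorem negativesAccumulateNe_dialSpace_of_dialReady₀ {p : ℕ} {β₀ : ℝ} (hβ₀ : 0 < β₀)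
    (hw : 0 < zetaWeights p) (hready : DialReady p β₀) :
    NegativesAccumulateNe dialSpace zetaDatum :=
  negativesAccumulateNe_dialSpace_of_dialReady hβ₀ hw (primePatternFormBoundedOn p) hready

/-- **PROVED (rev 2, leaf W2-unif in the dial space): every criterion with an `a`-uniform modulus at
`ζ` CONTAINS a detectably negative dial `≠ ζ`, modulo `DialReady p β₀` only.** [folklore] -/
theorem uniformlyRobustAt_contains_negative_dial₀ {p : ℕ} {β₀ : ℝ} (hβ₀ : 0 < β₀)
    (hw : 0 < zetaWeights p) (hready : DialReady p β₀)
    {S : Set Datum} (hS : UniformlyRobustAt S zetaDatum) :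
    ∃ d ∈ dialSpace, d ≠ zetaDatum ∧ d ∈ S ∧ DetectablyNegative d :=
  uniformlyRobustAt_contains_negative_dial hβ₀ hw (primePatternFormBoundedOn p) hready hS

/-- The `p = 2` instance of the rev-2 leaf (the observatory's `lambdapert`-type dial), modulo
`DialReady 2 β₀` only. [folklore] -/
theorem uniformlyRobustAt_contains_negative_dial_two₀ {β₀ : ℝ} (hβ₀ : 0 < β₀)
    (hready : DialReady 2 β₀) {S : Set Datum} (hS : UniformlyRobustAt S zetaDatum) :
    ∃ d ∈ dialSpace, d ≠ zetaDatum ∧ d ∈ S ∧ DetectablyNegative d :=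
  uniformlyRobustAt_contains_negative_dial₀ hβ₀ zetaWeights_two_pos hready hS

/-- **PROVED (rev 2, contrapositive packaging): a uniformly robust criterion at `ζ` that EXCLUDES every
detectably negative dial forces `¬ DialReady p β₀` for every weighted `p` and every `β₀ > 0`** — i.e.
such a criterion would itself be a theorem about the near-null profiles of `G − Z_ζ`. [folklore] -/
theorem not_dialReady_of_uniformlyRobust_excluding_negatives {S : Set Datum}
    (hS : UniformlyRobustAt S zetaDatum)
    (hexcl : ∀ d ∈ dialSpace, DetectablyNegative d → d ∉ S)
    {p : ℕ} (hw : 0 < zetaWeights p) {β₀ : ℝ} (hβ₀ : 0 < β₀) : ¬ DialReady p β₀ := by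
  intro hready
  obtain ⟨d, hd, -, hdS, hneg⟩ := uniformlyRobustAt_contains_negative_dial₀ hβ₀ hw hready hS
  exact hexcl d hd hneg hdS

end Summit.RiemannHypothesis.RiemannHypothesis.Theorems.PfPersistence
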